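import Literature.AnabelianGeometry.AbsoluteAnabelian.AbsTopIII.Thm19KummerTowerDictionary
import Literature.AnabelianGeometry.AbsoluteAnabelian.AbsTopIII.Thm19KummerTowerProofs
import Literature.AnabelianGeometry.AbsoluteAnabelian.AbsTopIII.Thm19KummerContainerEmbeddingPinned
import Literature.AnabelianGeometry.AbsoluteAnabelian.AbsTopIII.Thm19eProofs
import HarnessLib

/-!
# [AbsTopIII] Thm. 1.9 (e) over towers with dictionary: `Thm19e` from ONE `NFDictionary` per system
# (proof-only)

Mochizuki, *Topics in Absolute Anabelian Geometry III*, §1, Theorem 1.9 (e), manuscript p. 38 (lit key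
`paper:url-5493eb38cbb7`).  Proof-only companion of `Thm19KummerTowerDictionary.lean` (abc-iut-w5-d213;
sub-DAG `plan/L4/SUBDAG-AbsTopIII-Thm19.md`, row Thm19.e.r11): the closer `thm19e_of_dictionaryTower` —
the NAMED statement `Thm19e` from abc-iut-L4-t1's named facts `Prop_1_6_i`, `Prop_1_8_i`, `Prop_1_8_ii`,
`Prop_1_6_iii_units`, `Prop_1_6_iii_ker`, `Rmk_1_5_4_i` BY NAME and ONE dictionary-tower per directed
system: the embedding "`K_{Z_NF}^× ↪ lim`" is the PINNED one of `exists_functionFieldEmbedding_kummer`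
(Kummer-induced), so the tower forms (e2)(e3) of the dictionary transfer to it, and `thm19e`'s assembly
(`exists_isIso_evaluationTriple`) applies.  No definition; nothing here bears on [IUTchIII] Cor. 3.12.
-/

noncomputable section

open CategoryTheory
open scoped Classical

namespace Literature.AnabelianGeometry.AbsoluteAnabelian.AbsTopIII

open Literature.NumberTheory.DiophantineGeometry
open Literature.NumberTheory.DiophantineGeometry.AlgFunctionField

universe u

namespace IntrinsicKummerModel

namespace NFDictionary

variable {M : IntrinsicKummerModel.{u}} {Z : M.Curve} {ι : Type u} [Preorder ι]
  {S : CurveModel.NFComplementSystem M.toCurveModel Z ι} {Ω : Type u} [Field Ω]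
  [Algebra ↥(M.kbarNF Z) (M.NFFunctionField Z)]

/-- **The extracted triple of a system with a dictionary-tower is isomorphic to the function-field
triple** of `K_{Z_NF}/k̄_NF` (Prop. 1.6 (i)(iii), 1.8 (i)(ii), Rmk. 1.5.4 (i) BY NAME).
[cite: MochizukiAbsTopIII2015, Thm 1.9 (e) p.38] -/
theorem exists_isIso [Nonempty ι] [IsDirectedOrder ι] (D : M.NFDictionary S Ω)
    (hZ : M.IsThm19dInput Z) (h18i : M.Prop_1_8_i) (h18ii : M.Prop_1_8_ii)
    (h16u : M.Prop_1_6_iii_units) (h16k : M.Prop_1_6_iii_ker) (h16 : M.Prop_1_6_i)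
    (h154 : Rmk_1_5_4_i.{u}) :
    ∃ (φ : (M.evaluationTriple S).G ≃* (valuationEvaluationData ↥(M.kbarNF Z) (M.NFFunctionField Z)).G)
      (σ : (M.evaluationTriple S).I ≃ (valuationEvaluationData ↥(M.kbarNF Z) (M.NFFunctionField Z)).I),
      (M.evaluationTriple S).IsIso (valuationEvaluationData ↥(M.kbarNF Z) (M.NFFunctionField Z)) φ σ := by
  obtain ⟨i₀⟩ := ‹Nonempty ι›
  have hinjS := D.toNFTower.kummerToContainer_injective hZ h16 h154
  obtain ⟨e, he, hrange, hpin⟩ := M.exists_functionFieldEmbedding_kummer S D.res D.naturality Ω D.fnEmb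
    D.fnEmb_res D.nfEmb D.isNFRational_iff D.nfEmb_exhaust hinjS
  have hset := D.toNFTower.functionFieldPart_eq_nfRationalImage h18i h18ii h16u h16k h154 hZ
  -- every `f ∈ K_{Z_NF}^×` is represented by a regular unit of some level, and `e` is Kummer-induced
  have hrep : ∀ f : (M.NFFunctionField Z)ˣ, ∃ (j : ι) (g : M.regularUnits (S.V j)),
      D.fnEmb j ((g : (M.FunctionField (S.V j))ˣ) : M.FunctionField (S.V j)) =
        D.nfEmb (f : M.NFFunctionField Z) ∧
      e (Additive.ofMul f) = M.kummerToContainer S j (Additive.ofMul g) := fun f => by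
    obtain ⟨j, -, g, hg⟩ := D.nfEmb_exhaust i₀ (f : M.NFFunctionField Z) f.ne_zero
    exact ⟨j, g, hg, hpin f j g hg⟩
  refine M.exists_isIso_evaluationTriple S e he (hrange.trans hset.symm) D.pointPlace D.samePoint_iff
    D.pointPlace_surjective (fun f a n => ?_) (fun f a => ?_)
  · obtain ⟨j, g, hg, hef⟩ := hrep f
    rw [hef]
    exact D.hasOrderAt_iff j g f hg a n
  · obtain ⟨j, g, hg, hef⟩ := hrep f
    rw [hef]
    exact D.hasValueOneAt_iff j g f hg a

end NFDictionary

/-- **Thm. 1.9 (e) over dictionary-towers**: the NAMED statement `Thm19e` from Prop. 1.6 (i)(iii),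
Prop. 1.8 (i)(ii), Rmk. 1.5.4 (i) BY NAME and, per (d)-input `Z` and directed system `S`, ONE
`NFDictionary` (tower + dictionary, for some common field `Ω` and some `k̄_NF`-algebra structure on
`K_{Z_NF}`); `k`, `K` of `Thm19e` are `k̄_NF` (algebraically closed, `isAlgClosed_kbarNF`) and `K_{Z_NF}`.
[cite: MochizukiAbsTopIII2015, Thm 1.9 (e) p.38] -/
theorem thm19e_of_dictionaryTower (M : IntrinsicKummerModel.{u}) (h18i : M.Prop_1_8_i)
    (h18ii : M.Prop_1_8_ii) (h16u : M.Prop_1_6_iii_units) (h16k : M.Prop_1_6_iii_ker)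
    (h16 : M.Prop_1_6_i) (h154 : Rmk_1_5_4_i.{u})
    (hD : ∀ (Z : M.Curve), M.IsThm19dInput Z → ∀ (ι : Type u) [Preorder ι] [Nonempty ι]
      [IsDirectedOrder ι] (S : CurveModel.NFComplementSystem M.toCurveModel Z ι),
      ∃ (Ω : Type u) (_ : Field Ω) (_ : Algebra ↥(M.kbarNF Z) (M.NFFunctionField Z)),
        Nonempty (M.NFDictionary S Ω)) :
    M.Thm19e := by
  intro Z hZ ι _ _ _ S
  obtain ⟨Ω, _, _, ⟨D⟩⟩ := hD Z hZ ι S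
  obtain ⟨φ, σ, hiso⟩ := D.exists_isIso hZ h18i h18ii h16u h16k h16 h154
  have hg : 2 ≤ genus ↥(M.kbarNF Z) (M.NFFunctionField Z) := by
    rw [D.genus_eq]
    exact hZ.two_le_genus
  exact ⟨↥(M.kbarNF Z), M.NFFunctionField Z, inferInstance, inferInstance, inferInstance,
    M.isAlgClosed_kbarNF Z, D.isAlgFunctionField, hg, ⟨RingEquiv.refl _⟩, ⟨RingEquiv.refl _⟩,
    φ, σ, hiso⟩

end IntrinsicKummerModel

end Literature.AnabelianGeometry.AbsoluteAnabelian.AbsTopIII
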